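import Mathlib.Analysis.InnerProductSpace.PiL2
import Mathlib.LinearAlgebra.Matrix.DotProduct
import Mathlib.LinearAlgebra.Matrix.Hermitian
import Mathlib.LinearAlgebra.Matrix.Trace
import HarnessLib

/-!
# Orthogonal projection matrices onto a subspace of `ℂ^X`

Topic: `Literature/Computability/AlgebraicComplexity`; support file (finite-dimensional linear
algebra in coordinates) for the elementary proof of CVZ Thm. 3.34
(`ChristandlVranaZuiddam2023_le_upperSupportFunctional`, `QuantumFunctionals.lean`), which estimates
the weight `⟨ψ^{⊗n}, (P ⊗ 1 ⊗ 1) ψ^{⊗n}⟩ = tr(P ρ^{⊗n})` of a tensor power on a subspace `𝒲` of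
`ℂ^{ι^n}` through the orthogonal projection `P` onto `𝒲`. Everything is phrased for matrices acting on
coordinate vectors `X → ℂ` with the standard Hermitian form `star v ⬝ᵥ w`, so that it composes with
the `Matrix`/`actTensor` language of `QuantumFunctionals.lean`.

## Content (no definitions)

* `exists_orthonormalFrame W` — a subspace `W ≤ ℂ^X` has an orthonormal frame: a matrix
  `B : X × Fin k`, `k = dim W`, with `Bᴴ B = 1`, columns in `W`, and `B Bᴴ w = w` on `W`
  (Gram–Schmidt, via Mathlib's `stdOrthonormalBasis` of `W` inside `EuclideanSpace ℂ X`).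
* The projection `P = B Bᴴ`: Hermitian (Mathlib's `Matrix.isHermitian_mul_conjTranspose_self`),
  idempotent, range in `W`, `tr P = k`
  (`frame_proj_mul_self`, `frame_proj_mulVec_mem`, `frame_proj_trace`).
* `proj_unique` — a Hermitian matrix fixing `W` pointwise and mapping `ℂ^X` into `W` is unique; hence
  it equals `B Bᴴ`, has trace `dim W` (`trace_eq_finrank_of_proj`), and is invariant under
  conjugation by any unitary preserving `W` in both directions (`star_mul_proj_mul_eq_of_maps`).
* Quadratic forms of Hermitian idempotents: `0 ≤ re ⟨v, Q v⟩ ≤ re ⟨v, v⟩`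
  (`re_dotProduct_mulVec_nonneg`, `re_dotProduct_mulVec_le`), diagonal entries in `[0, 1]`.

All statements are folklore linear algebra.
-/

noncomputable section

open scoped BigOperators Matrix ComplexOrder InnerProductSpace

namespace Literature.Computability.AlgebraicComplexity

section Frame

variable {X : Type*} [Fintype X]

section Exists

/-- **Orthonormal frames exist**: every subspace `W` of `ℂ^X` (coordinate vectors with the standard
Hermitian form) has a matrix `B` with `k = dim W` orthonormal columns lying in `W` such that
`B Bᴴ` fixes `W` pointwise. [folklore] -/
theorem exists_orthonormalFrame (W : Submodule ℂ (X → ℂ)) :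
    ∃ (k : ℕ) (B : Matrix X (Fin k) ℂ), k = Module.finrank ℂ W ∧ Bᴴ * B = 1 ∧
      (∀ j, (fun x => B x j) ∈ W) ∧ ∀ w ∈ W, (B * Bᴴ) *ᵥ w = w := by
  -- transport `W` into the Euclidean space and take an orthonormal basis there
  set e : (X → ℂ) ≃ₗ[ℂ] EuclideanSpace ℂ X := (WithLp.linearEquiv 2 ℂ (X → ℂ)).symm with he
  set W' : Submodule ℂ (EuclideanSpace ℂ X) := W.map e.toLinearMap with hW'
  have hfin : Module.finrank ℂ W' = Module.finrank ℂ W := LinearEquiv.finrank_map_eq e W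
  set b := stdOrthonormalBasis ℂ W' with hb
  set k := Module.finrank ℂ W' with hk
  -- the frame: columns are the basis vectors read as coordinate vectors
  set B : Matrix X (Fin k) ℂ := Matrix.of fun x j => ((b j : W') : EuclideanSpace ℂ X) x with hB
  have hcol : ∀ j, (fun x => B x j) = WithLp.ofLp ((b j : W') : EuclideanSpace ℂ X) := fun j => rfl
  -- membership of the columns
  have hmemW : ∀ j, (fun x => B x j) ∈ W := by
    intro j
    obtain ⟨w, hw, hw'⟩ := Submodule.mem_map.1 (b j).2
    rw [hcol j, ← hw']
    simpa [he] using hw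
  -- orthonormality `Bᴴ B = 1`
  have hinner : ∀ j j', (Bᴴ * B) j j' = ⟪(b j : W'), (b j' : W')⟫_ℂ := by
    intro j j'
    rw [Submodule.coe_inner, EuclideanSpace.inner_eq_star_dotProduct]
    simp only [Matrix.mul_apply, Matrix.conjTranspose_apply, dotProduct, Pi.star_apply, hB,
      Matrix.of_apply]
    exact Finset.sum_congr rfl fun x _ => mul_comm _ _
  have hBB : Bᴴ * B = 1 := by
    ext j j'
    rw [hinner, Matrix.one_apply]
    exact orthonormal_iff_ite.1 b.orthonormal j j'
  -- `B Bᴴ` fixes `W`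
  have hfix : ∀ w ∈ W, (B * Bᴴ) *ᵥ w = w := by
    intro w hw
    have hv : e w ∈ W' := Submodule.mem_map_of_mem hw
    -- expansion of `⟨e w, hv⟩` in the orthonormal basis, read in coordinates
    have hexp := b.sum_repr' ⟨e w, hv⟩
    have hexpV : ∑ j, ⟪(b j : W'), (⟨e w, hv⟩ : W')⟫_ℂ • ((b j : W') : EuclideanSpace ℂ X) = e w := by
      have := congrArg (fun z : W' => (z : EuclideanSpace ℂ X)) hexp
      simpa only [Submodule.coe_sum, Submodule.coe_smul] using this
    have hcoef : ∀ j, ⟪(b j : W'), (⟨e w, hv⟩ : W')⟫_ℂ = (Bᴴ *ᵥ w) j := by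
      intro j
      rw [Submodule.coe_inner, EuclideanSpace.inner_eq_star_dotProduct]
      simp only [Matrix.mulVec, dotProduct, Matrix.conjTranspose_apply, Pi.star_apply, hB,
        Matrix.of_apply]
      refine Finset.sum_congr rfl fun x _ => ?_
      rw [mul_comm]
      rfl
    funext x
    have hx := congrArg (fun z : EuclideanSpace ℂ X => z x) hexpV
    simp only [WithLp.ofLp_sum, WithLp.ofLp_smul, Finset.sum_apply, Pi.smul_apply, smul_eq_mul] at hx
    rw [← Matrix.mulVec_mulVec]
    simp only [Matrix.mulVec, dotProduct]
    rw [show w x = e w x from rfl, ← hx]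
    refine Finset.sum_congr rfl fun j _ => ?_
    rw [hcoef j, mul_comm]
    simp only [Matrix.mulVec, dotProduct, hB, Matrix.of_apply]
  exact ⟨k, B, hfin.symm ▸ rfl, hBB, hmemW, hfix⟩

end Exists

/-- `B Bᴴ` is idempotent when `Bᴴ B = 1`. [folklore] -/
theorem frame_proj_mul_self {k : ℕ} {B : Matrix X (Fin k) ℂ} (hB : Bᴴ * B = 1) :
    B * Bᴴ * (B * Bᴴ) = B * Bᴴ := by
  rw [Matrix.mul_assoc, ← Matrix.mul_assoc Bᴴ, hB, Matrix.one_mul]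

/-- The range of `B Bᴴ` lies in the span of the columns of `B`. [folklore] -/
theorem frame_proj_mulVec_mem {k : ℕ} {B : Matrix X (Fin k) ℂ} {W : Submodule ℂ (X → ℂ)}
    (hcol : ∀ j, (fun x => B x j) ∈ W) (v : X → ℂ) : (B * Bᴴ) *ᵥ v ∈ W := by
  rw [← Matrix.mulVec_mulVec]
  have h : B *ᵥ (Bᴴ *ᵥ v) = ∑ j, (Bᴴ *ᵥ v) j • fun x => B x j := by
    funext x
    simp only [Matrix.mulVec, dotProduct, Finset.sum_apply, Pi.smul_apply, smul_eq_mul]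
    exact Finset.sum_congr rfl fun j _ => mul_comm _ _
  rw [h]
  exact Submodule.sum_mem _ fun j _ => Submodule.smul_mem _ _ (hcol j)

/-- `tr (B Bᴴ) = k` when `Bᴴ B = 1`. [folklore] -/
theorem frame_proj_trace {k : ℕ} {B : Matrix X (Fin k) ℂ} (hB : Bᴴ * B = 1) :
    (B * Bᴴ).trace = k := by
  rw [Matrix.trace_mul_comm, hB, Matrix.trace_one, Fintype.card_fin]

variable [DecidableEq X]

/-- **Uniqueness of the orthogonal projection**: two Hermitian matrices that fix `W` pointwise and
map everything into `W` coincide (`P P' = P'` and `P' P = P`, then take adjoints). [folklore] -/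
theorem proj_unique {W : Submodule ℂ (X → ℂ)} {P P' : Matrix X X ℂ} (hP : P.IsHermitian)
    (hP' : P'.IsHermitian) (hfix : ∀ w ∈ W, P *ᵥ w = w) (hinto : ∀ v, P *ᵥ v ∈ W)
    (hfix' : ∀ w ∈ W, P' *ᵥ w = w) (hinto' : ∀ v, P' *ᵥ v ∈ W) : P = P' := by
  have h1 : P * P' = P' := by
    refine Matrix.toLin'.injective (LinearMap.ext fun v => ?_)
    simp only [Matrix.toLin'_apply, ← Matrix.mulVec_mulVec]
    exact hfix _ (hinto' v)
  have h2 : P' * P = P := by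
    refine Matrix.toLin'.injective (LinearMap.ext fun v => ?_)
    simp only [Matrix.toLin'_apply, ← Matrix.mulVec_mulVec]
    exact hfix' _ (hinto v)
  calc P = Pᴴ := hP.symm
    _ = (P' * P)ᴴ := by rw [h2]
    _ = Pᴴ * P'ᴴ := Matrix.conjTranspose_mul _ _
    _ = P * P' := by rw [hP, hP']
    _ = P' := h1

/-- **A Hermitian matrix projecting onto `W` has trace `dim W`** (it is `B Bᴴ` for an orthonormal
frame). [folklore] -/
theorem trace_eq_finrank_of_proj {W : Submodule ℂ (X → ℂ)} {P : Matrix X X ℂ} (hP : P.IsHermitian)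
    (hfix : ∀ w ∈ W, P *ᵥ w = w) (hinto : ∀ v, P *ᵥ v ∈ W) :
    P.trace = Module.finrank ℂ W := by
  obtain ⟨k, B, hk, hBB, hcol, hBfix⟩ := exists_orthonormalFrame W
  rw [proj_unique hP (Matrix.isHermitian_mul_conjTranspose_self B) hfix hinto hBfix
      (frame_proj_mulVec_mem hcol), frame_proj_trace hBB, hk]

/-- A Hermitian matrix projecting onto `W` is idempotent. [folklore] -/
theorem mul_self_of_proj {W : Submodule ℂ (X → ℂ)} {P : Matrix X X ℂ}
    (hfix : ∀ w ∈ W, P *ᵥ w = w) (hinto : ∀ v, P *ᵥ v ∈ W) : P * P = P := by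
  refine Matrix.toLin'.injective (LinearMap.ext fun v => ?_)
  simp only [Matrix.toLin'_apply, ← Matrix.mulVec_mulVec]
  exact hfix _ (hinto v)

/-- **Unitary invariance**: if `U` is unitary and both `U` and `star U` map `W` into itself, then the
orthogonal projection onto `W` commutes with `U`: `star U * P * U = P`. [folklore] -/
theorem star_mul_proj_mul_eq_of_maps {W : Submodule ℂ (X → ℂ)} {P U : Matrix X X ℂ}
    (hP : P.IsHermitian) (hfix : ∀ w ∈ W, P *ᵥ w = w) (hinto : ∀ v, P *ᵥ v ∈ W)
    (hU : star U * U = 1) (hUW : ∀ w ∈ W, U *ᵥ w ∈ W) (hUW' : ∀ w ∈ W, star U *ᵥ w ∈ W) :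
    star U * P * U = P := by
  refine proj_unique ?_ hP ?_ ?_ hfix hinto
  · -- Hermitian
    have h : (star U * P * U)ᴴ = star U * P * U := by
      rw [Matrix.conjTranspose_mul, Matrix.conjTranspose_mul, hP.eq, ← Matrix.star_eq_conjTranspose,
        ← Matrix.star_eq_conjTranspose, star_star, Matrix.mul_assoc]
    exact h
  · intro w hw
    rw [← Matrix.mulVec_mulVec, ← Matrix.mulVec_mulVec, hfix _ (hUW w hw), Matrix.mulVec_mulVec, hU,
      Matrix.one_mulVec]
  · intro v
    rw [← Matrix.mulVec_mulVec, ← Matrix.mulVec_mulVec]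
    exact hUW' _ (hinto _)

end Frame

/-! ## Quadratic forms of Hermitian idempotents -/

section Quadratic

variable {X : Type*} [Fintype X]

/-- For a Hermitian idempotent `Q`, `⟨v, Q v⟩ = ⟨Q v, Q v⟩`. [folklore] -/
theorem star_dotProduct_mulVec_eq_of_proj {Q : Matrix X X ℂ} (hQ : Q.IsHermitian) (hQQ : Q * Q = Q)
    (v : X → ℂ) : star v ⬝ᵥ Q *ᵥ v = star (Q *ᵥ v) ⬝ᵥ Q *ᵥ v := by
  conv_lhs => rw [← hQQ, ← Matrix.mulVec_mulVec]
  rw [Matrix.dotProduct_mulVec, Matrix.star_mulVec, hQ.eq]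

/-- For a Hermitian idempotent `Q`, `0 ≤ ⟨v, Q v⟩` (in the star order of `ℂ`). [folklore] -/
theorem star_dotProduct_mulVec_nonneg {Q : Matrix X X ℂ} (hQ : Q.IsHermitian) (hQQ : Q * Q = Q)
    (v : X → ℂ) : 0 ≤ star v ⬝ᵥ Q *ᵥ v := by
  rw [star_dotProduct_mulVec_eq_of_proj hQ hQQ]
  exact dotProduct_star_self_nonneg _

/-- For a Hermitian idempotent `Q`, `0 ≤ re ⟨v, Q v⟩`. [folklore] -/
theorem re_dotProduct_mulVec_nonneg {Q : Matrix X X ℂ} (hQ : Q.IsHermitian) (hQQ : Q * Q = Q)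
    (v : X → ℂ) : 0 ≤ (star v ⬝ᵥ Q *ᵥ v).re :=
  (Complex.le_def.1 (star_dotProduct_mulVec_nonneg hQ hQQ v)).1

/-- For a Hermitian idempotent `Q`, `⟨v, Q v⟩` is real. [folklore] -/
theorem im_dotProduct_mulVec_eq_zero {Q : Matrix X X ℂ} (hQ : Q.IsHermitian) (hQQ : Q * Q = Q)
    (v : X → ℂ) : (star v ⬝ᵥ Q *ᵥ v).im = 0 := by
  have h := (Complex.le_def.1 (star_dotProduct_mulVec_nonneg hQ hQQ v)).2
  simpa using h.symm

variable [DecidableEq X]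

/-- `1 - Q` is a Hermitian idempotent along with `Q`. [folklore] -/
theorem one_sub_proj {Q : Matrix X X ℂ} (hQ : Q.IsHermitian) (hQQ : Q * Q = Q) :
    (1 - Q).IsHermitian ∧ (1 - Q) * (1 - Q) = 1 - Q := by
  refine ⟨Matrix.isHermitian_one.sub hQ, ?_⟩
  rw [Matrix.sub_mul, Matrix.mul_sub, Matrix.mul_sub, Matrix.one_mul, Matrix.mul_one, Matrix.one_mul,
    hQQ, sub_self, sub_zero]

/-- For a Hermitian idempotent `Q`, `re ⟨v, Q v⟩ ≤ re ⟨v, v⟩`. [folklore] -/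
theorem re_dotProduct_mulVec_le {Q : Matrix X X ℂ} (hQ : Q.IsHermitian) (hQQ : Q * Q = Q)
    (v : X → ℂ) : (star v ⬝ᵥ Q *ᵥ v).re ≤ (star v ⬝ᵥ v).re := by
  obtain ⟨h1, h2⟩ := one_sub_proj hQ hQQ
  have h := re_dotProduct_mulVec_nonneg h1 h2 v
  rw [Matrix.sub_mulVec, Matrix.one_mulVec, dotProduct_sub, Complex.sub_re] at h
  linarith

/-- The diagonal entry `Q x x` is the quadratic form of `Q` at the basis vector `e_x`. [folklore] -/
theorem star_single_dotProduct_mulVec_single (Q : Matrix X X ℂ) (x : X) :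
    star (Pi.single x (1 : ℂ)) ⬝ᵥ Q *ᵥ Pi.single x 1 = Q x x := by
  have h1 : Q *ᵥ Pi.single x 1 = fun y => Q y x := by
    funext y
    simp only [Matrix.mulVec, dotProduct, Pi.single_apply, mul_ite, mul_one, mul_zero,
      Finset.sum_ite_eq', Finset.mem_univ, if_true]
  rw [h1]
  simp only [dotProduct, Pi.star_apply, Pi.single_apply, apply_ite (star : ℂ → ℂ), star_one,
    star_zero, ite_mul, one_mul, zero_mul, Finset.sum_ite_eq', Finset.mem_univ, if_true]

/-- `⟨e_x, e_x⟩ = 1`. [folklore] -/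
theorem star_single_dotProduct_single (x : X) :
    star (Pi.single x (1 : ℂ)) ⬝ᵥ Pi.single x 1 = 1 := by
  simp only [dotProduct, Pi.star_apply, Pi.single_apply, apply_ite (star : ℂ → ℂ), star_one,
    star_zero, ite_mul, one_mul, zero_mul, Finset.sum_ite_eq', Finset.mem_univ, if_true]

/-- Diagonal entries of a Hermitian idempotent lie in `[0, 1]`: lower bound. [folklore] -/
theorem proj_diag_re_nonneg {Q : Matrix X X ℂ} (hQ : Q.IsHermitian) (hQQ : Q * Q = Q) (x : X) :
    0 ≤ (Q x x).re := by
  have h := re_dotProduct_mulVec_nonneg hQ hQQ (Pi.single x 1)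
  rwa [star_single_dotProduct_mulVec_single] at h

/-- Diagonal entries of a Hermitian idempotent lie in `[0, 1]`: upper bound. [folklore] -/
theorem proj_diag_re_le_one {Q : Matrix X X ℂ} (hQ : Q.IsHermitian) (hQQ : Q * Q = Q) (x : X) :
    (Q x x).re ≤ 1 := by
  have h := re_dotProduct_mulVec_le hQ hQQ (Pi.single x 1)
  rwa [star_single_dotProduct_mulVec_single, star_single_dotProduct_single, Complex.one_re] at h

omit [Fintype X] [DecidableEq X] in
/-- Diagonal entries of a Hermitian matrix are real. [folklore] -/
theorem proj_diag_im_eq_zero {Q : Matrix X X ℂ} (hQ : Q.IsHermitian) (x : X) : (Q x x).im = 0 := by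
  have h := hQ.apply x x
  rw [RCLike.star_def] at h
  have := congrArg Complex.im h
  simp only [Complex.conj_im] at this
  linarith

end Quadratic

end Literature.Computability.AlgebraicComplexity
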